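import Summits.CriticalPhenomena.PercolationContinuityZ3.Theorems.SahiMasterFamilyGluedFramesSafe

/-!
# Glued frames, III: pure independent families, two pure members, one member over a pure family, minimal annihilator points

Unit `prim-master-conj` (crux anchor stmt-CriticalPhenomena-4575), gen 11; memo HOME/prim-master-conj/TIGHTNESS-III.md §2.1–§2.5.
Order-free lemmas used by THEOREM LG4 (the local-to-global step at order four) — all about the gen-6 structure theory
(`GoodChain`/`Structured`/`cframe`) and the glued annihilators of `SahiMasterFamilyGluedFrames`:
* `goodChain_of_pairwise_disjoint`, **`structured_of_pairwise_disjoint`** — a family of increasing events with pairwise disjoint essential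
  supports is structured in every order (every annihilator is empty);
* **`exists_two_pure`** — a structured family with at least two members has two PURE members (canonical frame = member): the first two of
  any good chain;
* **`structured_insert_of_pairwise_disjoint`** — ONE member over a pure independent family: if the annihilator
  `hull (⋃ supports) (U v) ∖ U v` fails at least two of the pure members at every point, then the enlarged family is structured (this is the
  direction of the sandwich criterion used in TIGHTNESS-III 2.5: the condition is POINTWISE);
* `subset_esupp_of_minimal`, **`exists_minimal_gann`** — a non-pure member has a minimal point of its glued annihilator, which is a minimal
  point of the glued frame and lies inside the frame's essential support.
Pure combinatorics; axioms standard. [this work]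
-/

noncomputable section

open scoped Classical

namespace Summit.CriticalPhenomena.PercolationContinuityZ3.Theorems

namespace GluedFrames

open Finset Function
open Literature.Probability.LatticeModels.Kahn2022 (Affects)

variable {ι : Type*} [Fintype ι] {κ : Type*} (U : κ → Set (Set ι))

/-! ### Pure independent families are structured -/

/-- A list of members with pairwise disjoint essential supports and no repetition is a good chain (all annihilators are empty). [this work] -/
theorem goodChain_of_pairwise_disjoint (hU : ∀ k, IsUpperSet (U k)) :
    ∀ {l : List κ}, l.Nodup → (∀ w ∈ l, ∀ w' ∈ l, w ≠ w' → Disjoint (esupp (U w)) (esupp (U w'))) → GoodChain U l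
  | [], _, _ => goodChain_nil U
  | v :: l, hn, hd => by
    have hv : v ∉ l := (List.nodup_cons.1 hn).1
    have hl : GoodChain U l := goodChain_of_pairwise_disjoint hU (List.nodup_cons.1 hn).2
      (fun w hw w' hw' hne => hd w (List.mem_cons_of_mem v hw) w' (List.mem_cons_of_mem v hw') hne)
    rw [goodChain_cons]
    refine ⟨hl, hv, ?_⟩
    -- the frame of `v` over `l` is `U v` itself: empty annihilator
    have hfr : frameIn U (v :: l) v = U v := (frameIn_eq_self_of_pairwise_disjoint U hU hn hd).1 v List.mem_cons_self
    rw [frameIn_cons_self] at hfr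
    rw [hfr, Set.sdiff_self]
    exact Set.empty_subset _

/-- **A family with pairwise disjoint essential supports is structured.** [this work] -/
theorem structured_of_pairwise_disjoint (hU : ∀ k, IsUpperSet (U k)) {W : Finset κ}
    (hd : ∀ w ∈ W, ∀ w' ∈ W, w ≠ w' → Disjoint (esupp (U w)) (esupp (U w'))) : Structured U W :=
  ⟨W.toList, W.toList_toFinset, goodChain_of_pairwise_disjoint U hU (W.nodup_toList)
    (fun w hw w' hw' hne => hd w (mem_toList.1 hw) w' (mem_toList.1 hw') hne)⟩

/-! ### Two pure members -/

/-- Along a good chain of length `≥ 2` the first two members are pure: their frames are the members. [this work] -/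
theorem exists_two_frameIn_eq (hU : ∀ k, IsUpperSet (U k)) :
    ∀ {l : List κ}, GoodChain U l → 2 ≤ l.length →
      ∃ a ∈ l, ∃ b ∈ l, a ≠ b ∧ frameIn U l a = U a ∧ frameIn U l b = U b
  | [], _, h => by simp at h
  | [v], _, h => by simp at h
  | v :: x :: l', hl, _ => by
    have hn := GoodChain.nodup U hl
    have hvx : v ≠ x := fun e => (List.nodup_cons.1 hn).1 (e ▸ List.mem_cons_self)
    rcases Nat.lt_or_ge (x :: l').length 2 with hlt | hge
    · -- `l' = []`: the chain is `[v, x]`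
      have hl' : l' = [] := by
        have : l'.length = 0 := by simp only [List.length_cons] at hlt; omega
        exact List.eq_nil_of_length_eq_zero this
      subst hl'
      refine ⟨x, by simp, v, by simp, hvx.symm, ?_, ?_⟩
      · rw [frameIn_cons_of_ne U hvx.symm, frameIn_cons_self]; simp [frameSupp]
      · -- the annihilator of `v` over `[x]` is safe for `{x}`, i.e. empty
        have h3 := ((goodChain_cons U).1 hl).2.2
        rw [List.toFinset_cons, List.toFinset_nil, insert_empty_eq, safe_eq_empty_of_card_le_one U (by simp),
          Set.subset_empty_iff, Set.sdiff_eq_empty] at h3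
        rw [frameIn_cons_self]
        exact Set.Subset.antisymm h3 (subset_hull (hU v) _)
    · obtain ⟨a, ha, b, hb, hab, hfa, hfb⟩ := exists_two_frameIn_eq hU (GoodChain.tail U hl) hge
      have hav : a ≠ v := fun e => (List.nodup_cons.1 hn).1 (e ▸ ha)
      have hbv : b ≠ v := fun e => (List.nodup_cons.1 hn).1 (e ▸ hb)
      exact ⟨a, List.mem_cons_of_mem v ha, b, List.mem_cons_of_mem v hb, hab,
        by rw [frameIn_cons_of_ne U hav, hfa], by rw [frameIn_cons_of_ne U hbv, hfb]⟩

/-- **A structured family with at least two members has two pure members** (canonical frame = member). [this work] -/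
theorem exists_two_pure (hU : ∀ k, IsUpperSet (U k)) (hne : ∀ k, (U k).Nonempty) {W : Finset κ} (hW : Structured U W)
    (h2 : 2 ≤ W.card) : ∃ a ∈ W, ∃ b ∈ W, a ≠ b ∧ cframe U W a = U a ∧ cframe U W b = U b := by
  obtain ⟨l, hlW, hn, hlen, hl⟩ := Structured.exists_chain U hW
  obtain ⟨a, ha, b, hb, hab, hfa, hfb⟩ := exists_two_frameIn_eq U hU hl (hlen ▸ h2)
  subst hlW
  exact ⟨a, List.mem_toFinset.2 ha, b, List.mem_toFinset.2 hb, hab,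
    by rw [← frameIn_eq_cframe U hU hne hl ha, hfa], by rw [← frameIn_eq_cframe U hU hne hl hb, hfb]⟩

/-- Consequently at most `card − 2` members of a structured family (with `≥ 2` members) are non-pure. [this work] -/
theorem card_filter_not_pure_le (hU : ∀ k, IsUpperSet (U k)) (hne : ∀ k, (U k).Nonempty) {W : Finset κ} (hW : Structured U W)
    (h2 : 2 ≤ W.card) : (W.filter fun w => ¬ (cframe U W w ⊆ U w)).card + 2 ≤ W.card := by
  obtain ⟨a, ha, b, hb, hab, hfa, hfb⟩ := exists_two_pure U hU hne hW h2
  have hsub : (W.filter fun w => ¬ (cframe U W w ⊆ U w)) ⊆ (W.erase a).erase b := by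
    intro w hw
    rw [mem_filter] at hw
    refine mem_erase.2 ⟨fun e => hw.2 (e ▸ hfb.le), mem_erase.2 ⟨fun e => hw.2 (e ▸ hfa.le), hw.1⟩⟩
  have := card_le_card hsub
  rw [card_erase_of_mem (mem_erase.2 ⟨hab.symm, hb⟩), card_erase_of_mem ha] at this
  omega

/-! ### One member over a pure independent family -/

/-- **Structured by appending one member to a pure independent family**: if the members of `P` have pairwise disjoint essential supports,
`v ∉ P`, and every point of the annihilator `hull (⋃_{p∈P} esupp (U p)) (U v) ∖ U v` fails at least two members of `P`, then `insert v P` is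
structured.  (The good chain: any enumeration of `P`, then `v`; all sub-families of `P` are structured.) [this work] -/
theorem structured_insert_of_pairwise_disjoint (hU : ∀ k, IsUpperSet (U k)) {P : Finset κ} {v : κ} (hv : v ∉ P)
    (hd : ∀ w ∈ P, ∀ w' ∈ P, w ≠ w' → Disjoint (esupp (U w)) (esupp (U w')))
    (hann : ∀ φ : Set ι, φ ∈ hull (⋃ p ∈ P, (↑(esupp (U p)) : Set ι)) (U v) → φ ∉ U v → 2 ≤ (P.filter fun p => φ ∉ U p).card) :
    Structured U (insert v P) := by
  set l := P.toList with hldef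
  have hn : l.Nodup := P.nodup_toList
  have hlP : l.toFinset = P := P.toList_toFinset
  have hdl : ∀ w ∈ l, ∀ w' ∈ l, w ≠ w' → Disjoint (esupp (U w)) (esupp (U w')) :=
    fun w hw w' hw' hne => hd w (mem_toList.1 hw) w' (mem_toList.1 hw') hne
  have hl : GoodChain U l := goodChain_of_pairwise_disjoint U hU hn hdl
  refine ⟨v :: l, by rw [List.toFinset_cons, hlP], ?_⟩
  rw [goodChain_cons]
  refine ⟨hl, fun h => hv (mem_toList.1 h), ?_⟩
  have hS : frameSupp U l = ⋃ p ∈ P, (↑(esupp (U p)) : Set ι) := by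
    rw [(frameIn_eq_self_of_pairwise_disjoint U hU hn hdl).2, hlP]
  intro φ hφ
  rw [hS] at hφ
  rw [hlP, mem_safe]
  refine ⟨?_, fun R _ hRP => structured_of_pairwise_disjoint U hU fun w hw w' hw' hne => hd w (hRP hw) w' (hRP hw') hne⟩
  have : failSet U P φ = P.filter fun p => φ ∉ U p := rfl
  rw [this]
  exact hann φ hφ.1 hφ.2

/-! ### Minimal annihilator points -/

omit [Fintype ι] in
/-- A minimal configuration of an increasing event lies inside its essential support (as a set of coordinates). [folklore] -/
theorem subset_coe_esupp_of_minimal [Fintype ι] {A : Set (Set ι)} {μ : Set ι} (hμ : μ ∈ A) (hmin : ∀ x ∈ μ, μ \ {x} ∉ A) :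
    μ ⊆ ↑(esupp A) := by
  intro x hx
  rw [mem_coe, mem_esupp]
  refine ⟨μ \ {x}, hmin x hx, ?_⟩
  rwa [Set.insert_sdiff_singleton, Set.insert_eq_of_mem hx]

/-- **Minimal points of a glued annihilator.**  A non-pure member `w` (non-empty glued annihilator) has a point `μ` of its glued annihilator
which is minimal in the glued FRAME (removing any coordinate leaves the frame); such a point lies inside the frame's essential support.
[this work] -/
theorem exists_minimal_gann (hU : ∀ k, IsUpperSet (U k)) (W : Finset κ) {w : κ} (hN : (gann U W w).Nonempty) :
    ∃ μ ∈ gann U W w, (∀ x ∈ μ, μ \ {x} ∉ gframe U W w) ∧ μ ⊆ ↑(esupp (gframe U W w)) := by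
  -- minimise the number of elements over the (finite) annihilator
  obtain ⟨χ₀, hχ₀⟩ := hN
  have hfin : (gann U W w).toFinset.Nonempty := ⟨χ₀, Set.mem_toFinset.2 hχ₀⟩
  obtain ⟨μ, hμ, hmin⟩ := exists_min_image (gann U W w).toFinset (fun s : Set ι => s.ncard) hfin
  have hμN : μ ∈ gann U W w := Set.mem_toFinset.1 hμ
  have hminA : ∀ x ∈ μ, μ \ {x} ∉ gframe U W w := by
    intro x hx hA
    have hN' : μ \ {x} ∈ gann U W w := mem_gann_of_subset U W hU hμN Set.sdiff_subset hA
    have hle : μ.ncard ≤ (μ \ {x}).ncard := hmin _ (Set.mem_toFinset.2 hN')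
    have hlt : (μ \ {x}).ncard < μ.ncard :=
      Set.ncard_lt_ncard (Set.ssubset_iff_subset_ne.2 ⟨Set.sdiff_subset, fun e => by
        have : x ∈ μ \ {x} := e.symm ▸ hx
        exact this.2 rfl⟩) (Set.toFinite μ)
    omega
  exact ⟨μ, hμN, hminA, subset_coe_esupp_of_minimal hμN.1 hminA⟩

end GluedFrames

end Summit.CriticalPhenomena.PercolationContinuityZ3.Theorems
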